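import Literature.MathematicalPhysics.QuantumFieldTheory.Balaban1983to89.B10Eq66UpperForm
import Literature.MathematicalPhysics.QuantumFieldTheory.Balaban1983to89.DagBinding

/-!
# `Balaban1983to89.B10Carve32SectsCDThm2Hyp` — [Balaban1985UV3] pp. 267–275 (Sect. B's close (44)–(47), Sect. C «Renormalization
# Transformation Preserves The Form of the Inductive Inequality» (48)–(63), THEOREM 2 p. 272, Sect. D «Concluding Remarks»
# (64)–(71)): P6 CARVING-FAN BLOCK 32 — the block's one residual printed sentence in hypothesis form and ONE hypothesis
# bundle `Hyp` of the section's printed statements BY NAME, keyed to the consumer (`stmt-QuantumFields-20542`, K1⁷; DAG node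
# n08 [B10] = the leaf `b10 := B10.Thm1Printed runs ∧ B10.Thm2Printed runs` of `DagBinding.Upstream.ofPrinted`)

statement-level skeleton of published theorems with citation tags; proofs where landed; nothing here is a claim about the
Yang–Mills mass gap

T. Bałaban, *Ultraviolet stability of three-dimensional lattice pure gauge field theories*, Commun. Math. Phys. **102** (1985)
255–275, doi:10.1007/bf01229380 `[Balaban1985UV3]` (cell paper "B10"; journal page = PDF page + 254).  STATUS: published,
refereed; d = 3 THROUGHOUT (the superrenormalizable sibling of the d = 4 series; every `…Printed` statement of the cell's
B10 cluster is consumed downstream only as a hypothesis).  PDF held: `paper:balaban1985-cmp102-uv-stability-3d`; pp. 267–275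
[PDF 13–21] read by this seat on the text layer (`p0013.txt` … `p0021.txt`, line locators «`p00NN.txt:Ln`» below) AND AS IMAGES
(renders `run/shared/lean/pub/pub-balaban/b2b-balaban-ref1/pages/1985-cmp102-uv-stability-3d/…-p013-x2.png`, `-p016-x2.png`,
`-p018-x2.png`, `-p019-x2.png`, 2026-08-28).  [4] of B10's list = `[Balaban1985Averaging]` (cell B7); [5] =
`[Balaban1985BackgroundPropagators]` (B9); [6] = `[Balaban1985RegularSpaces]` (B8); [7] = `[Balaban1985Variational]` (B11);
[9] = `[Balaban1982Higgs2]` ((Higgs)₂,₃ II).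

CITATION HEADER (lean-in-tree rule).  Cell `lit-balaban` (HOME `run/shared/lean/pub/lit-balaban/`), P6 CARVING FAN (D-0154
(3b)), block 32 of `carve/BLOCKS-31-40.md` v1.1/v1.2 (lead g30, 2026-08-28T05:52Z; claimed by seat `carve-01` g6 under RULING #7 (5),
`carve/STATUS.md` 07:29:18Z, confirmed RULING #8 07:30:58Z): «[B10] Sects. C–D: renormalization transformation preserves the
inductive inequality (44)–(63); Thm 2 p.272 ((41),(47)); concluding remarks (64)–(71); 29 SKELETON rows (typed-existing 15,
proved 10, typed 2, proved-existing 2); KEY stmt-QuantumFields-20542, also-feeds 20544, 19936».  Filed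
`--supports stmt-QuantumFields-20542`.  RULES (`carve/CARVE-RULES.md` §2): IN TREE = CITE, NEVER RESTATE; residual printed
statements in hypothesis form `def …Printed : Prop`; ONE bundle `Hyp`; no `instance`, no `notation`, 0 `sorry`.

## WHAT THE BLOCK'S PAGES PRINT AND WHERE THE TREE HOLDS IT (cite table — every SKELETON row of block 32 is IN TREE; nothing in
## this table is restated below; `B10.X` = `…Balaban1983to89.B10.X`, file `B10.lean`, etc.)
* p. 267 ll. 1–3 (`p0013.txt:L2–L4`) «The configuration U_k satisfies the following regularity condition on Ω_k: |U_k(∂p) − 1| <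
  2L²B₃g_{k−1}p(g_{k−1})η². This implies the condition |Ū_k^j(∂p′) − 1| < 4L²B₃g_{k−1}p(g_{k−1})(L^jη)² for p′ ⊂ Ω_k^{(j)}» and
  row B10.Eq44 **(44)**: `B10SectCExpansion.Bound44` (hypothesis shape; `bound44_of_shape43`, `bound44_two_powers` PROVED), the
  sentence PROVED for the concrete j-fold average in `B10Eq44AvgRegularity.reg44_avg` (+ `_local`, `_unitaryGroup`,
  `_specialUnitary`), `B10Eq44Concrete.bound44_concrete`, `B10Eq44OnDomain`, `B10Eq44SpecialUnitary`.
* row B10.Eq45 **(45)** «By the assumption n ≥ 2, summation over all Y_j with y fixed yields for g_{k−1} sufficiently small …»: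
  `B10SectCExpansion.Bound45`, PROVED from (44) in `B10SectCExpansion.bound45_of_bound44`, `B10Eq44Concrete.bound45_concrete`.
* row B10.Eq46 **(46)** and the remark p. 267 ll. 21–30 («Each renormalization transformation increases the index of the minimal
  configuration by 1, hence the right-hand side of the bound (44) decreases by the factor L^{−2n}. Because n ≥ 2, so L^{−2n} ≤ L^{−4}
  … In the four-dimensional case … a coupling constant renormalization, is needed.»): `B10.Bound46Printed` (typed, verbatim there)
  — IN THE BUNDLE (`Hyp.b46`); PROVED one level down: `B10SectCExpansion.bound46_of_bound45`, `B10.powerCounting_d3` /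
  `powerCounting_d4`, `B10Eq44Concrete.bound46_concrete`, `B10Eq44SpecialUnitary.bound46_specialUnitary`; its Sect. D use
  `B10.Pint_le_of_bound46` (`Hyp.pint_le`).
* row B10.Eq47 **(47)** «Analogously to (37) we assume the lower bound (47) … where the characteristic function χ_k corresponds to
  the restrictions on V given by the conditions |U_k(∂p) − 1| < g_kp(g_k)η², p ⊂ T_η»: `B10.Ineq47` over the carrier
  `B10.TowerRun` (the LOWER INDUCTIVE ASSUMPTION: input and output of the Sect. C step `B10.SectCStepPrinted`, and the lower
  half of Theorem 2's conclusion through the binding `B10.SpecOK` — `Hyp.ineq41_47`); the small-field volume it needs: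
  `B10Eq47Volume`, `B10Eq47VolumeSidak`, `GaussianSmallField.SidakInequality_holds` (PROVED); the α-track readings with constants
  pulled out `T3AlphaInputsAC.Ineq47At`, `T3AlphaInputsAC.Ineq47AE` (consumer side; cited, not used here).
* Sect. C frame, p. 267 l. 32 – p. 268 («We apply the renormalization transformation T to the density ρ_k, and we use the
  inductive inequality (41) … Now we do the same operations as in the first step»), rows B10.SectC, B10.Eq48–B10.Eq52 ((48), (49),
  the saddle point «We take the minimal configuration V_k^{(k)} … If we substitute it in U_k in place of V_k↾Λ_k, we get the
  configuration U_{k+1}», the p. 268 bounds «|V′_k − 1| < 16·3²L²B₃g_kp(g_k)», «|A′| < 32·3²L²B₃g_kp(g_k)», (50)–(52)):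
  `B10.SectCStepPrinted` (the inductive step as ONE leaf, verbatim there, census S-C1…S-C6) — IN THE BUNDLE (`Hyp.sectC`);
  its located parts: `B10LargeField.DomainSeq`/`Rule268`/`Λ` and `B10Decomposition7.resummation48`, `zetaStep_local` (the
  p. 268 domains and ζ_{Λ_k}, PROVED), `B10NestedMinimizer.StepData`/`effFib`/`EffSpace`/`IsVkk` ((48)–(52)),
  `B10Eq13RegularityClaims.claim268`, `B10Eq13Enlargement.claim268_enlarged` (PROVED), `B10.edge_B8Lemma1_alpha1_zero`,
  `B10Eq55GaussianStep.integrand51` ((51)).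
* rows B10.Eq53, B10.Eq54 **(53)–(54)** p. 269 (with «We have used also orthogonality relations following from the definitions of
  operations and configurations used above»): `B10SectCExpansion.ExpansionData`, `Line2_53`, `Orthogonality53`, `Expansion53`,
  `QuadForm54` (hypothesis shapes) with `expansion53_of_line2`, `quadForm54_unique`, `expansion53_54` PROVED;
  `B10Eq19LinearTerm.orthogonality53_of_minimality`, `expansion53_of_minimality` (the orthogonality relations DERIVED),
  `B10Eq54QuadForm`.
* rows B10.Eq55, B10.Eq58–B10.Eq62 **(55), (58)–(62)** pp. 269–271 and the remainder sentences p. 269 l. 23 («The remainders for both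
  expressions are estimated by O(g⁷p¹⁸(g_k))|B(Λ_{k+1})| ≤ O((L^kε)^{3+κ₀})|T₁^{(k)}|» ⟦g_k⁷⟧), p. 270 («the error being of the
  order O((L^kε)^{3+κ₀})|T₁^{(k)}|»): the fourteen STEP LEAVES `B10SectAGathering.Bound55`, `Bound55Lower`, `Cumulant58`,
  `CumulantLower`, `Repr33_60`, `VacuumWhole`, `Decomp35_61`, `Norm35`, `StarCount`, `OldOutside`, `PintSucc`, `Estep62`,
  `ZtermSucc`, `RmSucc` over `StepPieces`, bundled as `B10SectAGathering.StepLeaves`, with `step_of_leaves` /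
  `sectCStep_of_leaves` PROVED (step leaves ⇒ `B10.SectCStepPrinted`) and the remainder power counting
  `B10SectAGathering.remainder_powerCounting`, `B10Assembly.cumulant58_of_raw`, `rawConst`, `repr33_60_of_raw`,
  `decomp35_61_of_raw`, `cumulantLower_of_raw`, `vacuumWhole_of_raw` PROVED; (59)'s two localisation sentences PROVED at one
  scale in `B10Eq59Localization` (`sum_abs_act_outside_le_of_bound25`, `sum_abs_act_large_le_of_bound25`); the cumulant model
  `B10Eq24Cumulant.FluctuationModel`, `LocalizationUpper`/`LocalizationLower`; (55) on a Gaussian step `B10Eq55GaussianStep`.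
* rows B10.Eq56, B10.Eq57 **(56)–(57)** pp. 269–270 (incl. «We sum up all the coefficients at the same monomial in A. We get a
  coefficient which, by bound similar to (45), (46), can be estimated as in (56) (with O(g_k^m))»): `B10SectCExpansion.VertexGeometry`,
  `Bound56`, `Bound57`, `Bound56Resummed` (hypothesis shapes), `bound56_irrelevant` PROVED; `B10Eq57Resummation` (`leg57`,
  `geomTail`, `resum`).
* p. 270 ll. 30–34 (the (59) trichotomy) and **(59)**: as above (`Cumulant58`, `VacuumWhole`, `B10Eq59Localization`); p. 270
  ll. 35–38 «The terms 𝒫′_{k+1} satisfy the bound (25) (with the indices 1, 0 replaced by k + 1, k), and are gauge invariant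
  functions of U_{k+1} …»: the bound half is `B10.Bound25Printed` (generic in the step; its docstring quotes this sentence); the
  gauge-invariance half at step k + 1 had NO declaration of record ((26) p. 263 is typed for 𝒫′₁ in the C⋆-tube model as
  `B10Eq26SiteGauge.SiteGaugeInv`, and for the local terms of (61) as `B10Eq61SpineCoefficient` §6–§7 /
  `B10Eq61LocalTermSize` §8) — §1 below.
* p. 271 ll. 1–13, row B10.Eq60 **(60)** («We use results of Sect. F [7], and we construct the representation U_{k+1} = exp iη𝓗(B)
  (modulo a gauge transformation) … The same conclusion (32) holds for the first order functional derivative of 𝒫′_{k+1}(g_k, X,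
  exp iη𝓗) at 𝓗 = 0 …»): `B10SectAGathering.Repr33_60`; `B10Eq61PerSite.LineInDomain`, `DerivZeroAlong`/`DerivZeroAlongV`
  ((32) at p. 271), `taylorRemAlong`; `B10Eq29TubeLine.expLine`; `B10.invariant_vector_eq_zero` ((31) ⇒ (32) from Mathlib).
* rows B10.Eq61–B10.Eq63 **(61)–(63)** pp. 271–272 (the Gaussian integral, the variables A′ of [5] Sect. E, «the sum of terms
  −log det S(V^{(k)}, b₀(c)). They are simple, local, gauge invariant functions of V^{(k)} = U_{k+1}», «The number γ₁ is an upper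
  bound of the positive, bounded operator C*Δ_kC», the G̃₃(x) representation «This term determines a non-negative, bounded and
  almost local operator», «gathering together the first terms in the expansions (30) we obtain the expansion of (63) for the
  external field U_{k+1} = 1. This is cancelled by the second term in (61)»): `B10SectAGathering.Decomp35_61`;
  `B10Eq61EliminationTerms`, `B10Eq61LocalTermSize`, `B10Eq61SpineCoefficient`, `B10Eq61CoefficientOnLie`, `B10Eq61DetPositive`,
  `B10Eq61GaussianLogarithm`, `B10Eq61PerSite`, `B10Eq61Leaves`; **(63)** PROVED as `B10LogDet63.matrix63` with
  `B10.logdet63_skeleton`, `B10Eq63Contour` (`cutUpper`, `cutLower`, `keyholeIntegral`, `resolventTrace`), `B10Eq63Rep.G3Rep`/`G3Cont`,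
  `B10LogDet63.G3WalkBound` (hypothesis shape of the walk expansion of G̃₃).
* p. 272 ll. 28–33 («Thus we have estimated ρ_{k+1} by an expression which is almost equal to the right-hand side of the inductive
  assumption (41) for k + 1. To get the exact inequality we estimate a sum of all terms 𝒫_j(Y_j, U_{k+1}) with localizations Y_j
  not contained in Ω_{k+1} by O(1)|Λ_k|, or by O(1)|Z_k|. The lower bound is proved in the same way, with all simplifications
  coming from the fact that Ω_{k+1} = T_η.»): `B10SectAGathering.OldOutside` (the |Z_k| option), `Bound55Lower`, `CumulantLower`;
  `B10Thm2Exactness` (the touching form PROVED from (25)); inside `B10.SectCStepPrinted`'s verbatim frame.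
* row B10.Thm2 **THEOREM 2** p. 272 («The sequence of densities ρ_k defined by the inductive equations (2), with ρ₀ given by (1),
  satisfies the inequalities (41), (47).»): `B10.Thm2Printed` (typed-existing, verbatim) — IN THE BUNDLE (`Hyp.thm2`); its printed
  proof shape PROVED as bookkeeping: `B10.ineqs_of_sections`, `B10.thm2_of_sections` ((1)₀ + Sect. A + Sect. C by induction on k),
  one level down `B10SectAGathering.thm2_of_leaves`, `B10Assembly.thm2_of_leafSystem`; the record objects `B10RunsOfRecord.Repr41_47`,
  `PrintedUV3`, `B10CompactBinding.ofPrintedAllXPNC`.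
* row B10.SectD, p. 272 l. 37 – p. 274 l. 4 **Sect. D** («We have to show that the inequalities (41), (47) imply Theorem 1, i.e. the
  inequalities (5). … We estimate the interaction terms using the bounds (44)–(46) by O(1)M₁³g²_{k−1}p²(g_{k−1})|Λ_k| ≤ O(1)|T₁^{(k)}|»):
  `B10.Thm1OfThm2Leaf` (the implication leaf, typed-existing) — IN THE BUNDLE (`Hyp.sectD`); its kernel route under the audit
  reading of Theorem 1 (cell GAPS G-B10-01: the `d(𝔤) log g_k|T₁^{(k)*}|` term of (62) makes print's O(1) window-dependent, so the
  tree derives `B10.Thm1PrintedCompact`, not the one-sided `B10.Thm1Printed`): `B10.gsq_psq_le`, `B10.Pint_le_of_bound46`,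
  `B10.upper5_of_41`, `B10.lower5_of_47`, `B10.bounds5At_of_ineqs`, `B10.thm1Compact_of_thm2`,
  `B10Assembly.thm1Compact_and_thm2_of_leafSystem` (the whole paper as one kernel implication over `B10Assembly.LeafSystem`).
* rows B10.Eq64, B10.Eq65 **(64)–(65)** p. 273 («From (25), which holds for arbitrary j, we get easily |E^{(j)}| ≤ O(1)|T₁^{(j)}|»):
  `B10.Ek` (definition with body), `Ek_zero`, `Ek_succ`, `Ek_top`, `B10.Estep62_abs_le`, `Ek_abs_le`, `Ecst_abs_le`,
  `Ecst_abs_le_window` (PROVED, with the log term explicit); `B10Assembly.LeafSystem.estep_abs_le`/`ecst_abs_le`, `B10Eq65PolymerSum`.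
* row B10.Eq66 **(66)** p. 273 («We obtain a bound of the form (41) with the expression (66) in the exponential»):
  `B10Eq66UpperForm.Ineq66` (definition with body over `B10.TowerRun`), PROVED from (41) + the three Sect. D piece bounds in
  `B10Eq66UpperForm.ineq66_of_41` and for every run of a leaf-system family in `ineq66_of_leafSystem` / `_log`; its use
  `upper5_of_66` — no slot (a PROVED step; `Hyp.ineq66`, `Hyp.upper5_via66`).
* rows B10.Eq67–B10.Eq71 **(67)–(71)** p. 273 and p. 273 l. 28 – p. 274 l. 4 («for g_j sufficiently small. Thus the part of the action
  1/g_k²A^η(U_k) localized to the sum of four j-blocks Δ′ connected with the plaquette p′ can be bounded from below by 1/4p²(g_j) … We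
  get these small factors for all plaquettes in all large fields set P. … The analysis of Sect. 3.C [9], which is model independent,
  show that these small factors are enough to control all sums in (41), together with the second term in (65) ⟦(66)⟧. This gives the
  upper bound in (5). The lower bound is simpler, it is enough to use (44)–(46) and (66) ⟦(65)⟧. Thus we have completed the proof of
  Theorem 1.»): `B10.LargeFieldControlPrinted` ((67)–(71) + [9] Sect. 3.C as the ONE inequality Sect. D consumes, verbatim there) —
  IN THE BUNDLE (`Hyp.lf`); its printed inputs PROVED/typed: `B10.eq70_sq_step`, `B10.eq71_arith`, `B10Eq68TorusRegularity`,
  `B10Eq69Iteration`, `B10Eq69Concrete`, `B10Eq69Local`, `B10Eq69TorusPullback`, `B10Eq70Squaring`, `B10Eq70Concrete`,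
  `B10Eq71Concrete`, `B10Eq71TorusLocal`, `B10Eq71TorusOverlap`, `B10Eq71AllPlaquettes`, `B10LargeFieldSum.SmallFactorsAll` /
  `ZtermRate` / `ZvolCover` and `largeFieldControl_of_resummation_gRun` (the {Ω_j}-summation DERIVED from per-plaquette leaves),
  `B10LargeField.LargeFieldControlVia9` (the same sentence with [9]'s provisos 2 ≤ r₀, 4r₀ ≤ 2p₀ explicit; cell GAPS G-B10-02),
  `B10LargeField.penalty`, `B10StarCount`, `B10StarLower`.
* pp. 274–275: references [1]–[28], «Communicated by A. Jaffe» — no statement.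

RESULT OF THE CENSUS (text layer pp. 267–275 whole + renders p013/p016/p018/p019 as images; every display (44)–(71), the head
Theorem 2 and the constants clauses p. 267 «for g_{k−1} sufficiently small», p. 268 «g_k sufficiently small», p. 273 «for g_j
sufficiently small» checked against `HOME/EXISTING-DECLS.tsv` (672 in-range decls, 76 files) and `lit-balaban-r07/ROWS-B10.md`
v1.150): ONE printed sentence of the block lacks a declaration of record — the step-(k+1) gauge invariance of the localized terms
𝒫′_{k+1} (p. 270 ll. 35–38; §1).  Everything else is cited above and takes no new `…Printed` statement.

## WHAT THIS FILE ADDS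
§1 `Terms59Printed` — p. 270 ll. 35–38 in hypothesis form over the carrier of (25) (`B10.PolymerActivities`: the localization
domains X, the configurations «having regularity properties similar to the properties of U_{k+1}», 𝓛(X), the activities
𝒫′_{k+1}(g_k, X, ·)), the gauge transformations and their action on that configuration space being explicit parameters: the
bound half BY NAME (`B10.Bound25Printed A g_k κ C`) ∧ the invariance half `𝒫′(X, Uᵘ) = 𝒫′(X, U)`; companions `Terms59Printed.bound25`,
`.gaugeInv`, `.abs_act_gauge_le` (kernel trivialities: the bound holds at every gauge transform).
§2 THE BUNDLE.  `Carriers I` — the data the §1 statement takes per run i and step k (plain data, no instances); `Hyp T X` over a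
family `T : I → B10.TowerRun` of runs on the cell's carrier of record (the carrier of (41)/(47)/(5), `B10.TowerRun ⊇ B10.RunData`) —
the block's printed STATEMENTS as hypotheses BY NAME, one field each: (46) `B10.Bound46Printed`, Sect. C `B10.SectCStepPrinted`,
p. 270 `Terms59Printed`, Theorem 2 `B10.Thm2Printed`, Sect. D `B10.Thm1OfThm2Leaf`, (67)–(71)+[9] `B10.LargeFieldControlPrinted`.
The other displays of the block ((44)–(45), (48)–(63), (64)–(66), (69)–(71)) are PROVED ∕ bodied ∕ typed as the inputs of these in
the sibling modules of the table above and take no slot (block-40 precedent `B16Carve40BoundsCor3Hyp`).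
§3 KERNEL-CHECKED BOOKKEEPING out of `Hyp` (no statement asserted): ★ `Hyp.b10Leaf` — the bundle yields the DAG's node-n08 leaf
`B10.Thm1Printed runs ∧ B10.Thm2Printed runs` (Sect. D's leaf applied to Theorem 2), and `Hyp.dag_b10` — literally the field
`(DagBinding.Upstream.ofPrinted P b9 b11 rOp rBS).b10` of the K-consumer's upstream binding when `P.runs10` is the family (the
same field in every later binding: `DagBinding.ofPrintedR_leaves`, `ofPrintedAllXP_leaves`); `Hyp.ineq41_47` — (41) ∧ (47) at
every k ≤ K through the binding `B10.SpecOK`; `Hyp.thm2_of_sectionsAB` — the `thm2` slot is Theorem 2's printed proof shape: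
with the two block-31 members (1)₀ `B10.Step0Printed` and (36)–(37) `B10.FirstStep36_37Printed` the `sectC` slot alone re-derives
`B10.Thm2Printed` (`B10.thm2_of_sections`); `Hyp.pint_le` ((46) ⇒ Sect. D line 1, `B10.Pint_le_of_bound46`); `Hyp.ineq66` ((41)_k +
piece bounds ⇒ (66), `B10Eq66UpperForm.ineq66_of_41`); `Hyp.upper5_via66` ((66) + `lf` ⇒ the upper half of (5),
`B10Eq66UpperForm.upper5_of_66`); ★ `Hyp.bounds5At` — Theorem 2 + (46)-type piece bounds + `lf` ⇒ the bounds (5) AT EVERY STEP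
with O(1) = a + b + c + d (`B10.bounds5At_of_ineqs`), the honest per-window content of the `sectD` slot; `hyp_of_leafSystem` —
four of the six slots (`b46`, `sectC`, `thm2`, `lf`) are CONSEQUENCES of the cell's located leaf system `B10Assembly.LeafSystem`
(the two others, `t59` and the one-sided `sectD`, are supplied); `hyp_trivRun` — the bundle is INHABITED (the cell's trivial run
`B10Assembly.trivRun K` with zero activities), so the six slots are jointly satisfiable as typed.

## HONEST SCOPE
Nothing of [Balaban1985UV3] is proved here beyond bookkeeping between typed shapes; (46), the Sect. C step, Theorem 2, the
Sect. D leaf and the large-field control are NOT re-proved (hypothesis slots, exactly the cell's leaves); `sectD` carries the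
ONE-SIDED printed reading `B10.Thm1Printed` of Theorem 1's uniformity clause, which the cell's audit (GAPS G-B10-01,
`B10.Thm1PrintedCompact`, `B10Assembly`) records as NOT derivable from the printed leaves for families with arbitrarily small
couplings — the slot is the printed sentence «the inequalities (41), (47) imply Theorem 1», not an endorsement, and `Hyp.bounds5At`
states what the leaves do give; the residual sentence is typed over the abstract carrier of (25), not on a lattice carrier (the
C⋆-tube model form of (26) is `B10Eq26SiteGauge.SiteGaugeInv`); with carriers chosen freely the bundle is inhabited by trivial data
(`hyp_trivRun`) and earns its keep only at Bałaban's own objects (1)–(2), which no module constructs.  No summit statement is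
proved by this seat; K1⁷ ∕ node n08 is NOT discharged; count-neutral; one lattice paper in d = 3 — nothing continuum ∕ ℝ⁴ ∕ OS ∕
mass-gap ∕ Clay.  No `sorry`, no `instance`, no `notation`, no attribute manipulation; imports `…B10Eq66UpperForm` (hence
`…B10Assembly`, `…B10`, `…B10LargeField`, `…B10SectAGathering`) and `…DagBinding` only.
-/

noncomputable section

namespace Literature.MathematicalPhysics.QuantumFieldTheory.Balaban1983to89.B10Carve32SectsCDThm2Hyp

open B10 (TowerRun RunData PolymerActivities Bound25Printed Bound46Printed SectCStepPrinted Thm2Printed Thm1Printed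
  Thm1OfThm2Leaf LargeFieldControlPrinted SpecOK Ineq41 Ineq47 Step0Printed FirstStep36_37Printed Bounds5At)

/-! ## §1  The residual printed sentence of p. 270 (hypothesis form) -/

/-- **p. 270, ll. 35–38 [PDF 16]** (`p0016.txt:L35–L38`; render `…-p016-x2.png` read as image), verbatim: «The terms 𝒫′_{k+1}
satisfy the bound (25) (with the indices 1, 0 replaced by k + 1, k), and are gauge invariant functions of U_{k+1}, in fact of an
arbitrary gauge field configuration having regularity properties similar to the properties of U_{k+1}.» — the two properties of
the localized terms of **(59)** «Σ_X 𝒫′_{k+1}(g_k, X, U_{k+1}) over localizations X ⊂ Ω_{k+1}, which are connected unions of big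
blocks, and which are contained in cubes of the size R(g_k)M₁» that the renormalisation (60) and the vacuum sum (62) consume.
TYPED over the carrier of (25) (`B10.PolymerActivities`: `A.Poly` = the localizations X, `A.Cfg` = the gauge field configurations
«having regularity properties similar to the properties of U_{k+1}» on which the terms are defined, `A.ℒ` = 𝓛(X), `A.act X U` =
𝒫′_{k+1}(g_k, X, U)), with the gauge transformations `𝓖` and their action `gact u U = Uᵘ` on `A.Cfg` explicit parameters, `gk` = g_k,
`κ`, `C` the constants of (25): FIRST HALF BY NAME — (25) p. 262 «|𝒫′₁(g₀, X, U₁)| ≤ O(g₀)exp(−κ𝓛(X))» with 1, 0 ↦ k + 1, k is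
`B10.Bound25Printed A g_k κ C` —, SECOND HALF the invariance `𝒫′_{k+1}(g_k, X, Uᵘ) = 𝒫′_{k+1}(g_k, X, U)` for all u, X, U ((26) p. 263
at step k + 1; the C⋆-tube MODEL form of (26) for 𝒫′₁ is `B10Eq26SiteGauge.SiteGaugeInv`, not restated: other carrier).
Hypothesis slot; nothing asserted. [cite: Balaban1985UV3, p.270 ll.35–38 (after (59)); (25) p.262; (26) p.263] -/
def Terms59Printed (A : PolymerActivities) {𝓖 : Type*} (gact : 𝓖 → A.Cfg → A.Cfg) (gk κ C : ℝ) : Prop :=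
  Bound25Printed A gk κ C ∧ ∀ (u : 𝓖) (X : A.Poly) (U : A.Cfg), A.act X (gact u U) = A.act X U

section Terms59

variable {A : PolymerActivities} {𝓖 : Type*} {gact : 𝓖 → A.Cfg → A.Cfg} {gk κ C : ℝ}

/-- Unfolding (definitional). [cite: Balaban1985UV3, p.270 ll.35–38] -/
theorem terms59Printed_iff :
    Terms59Printed A gact gk κ C ↔
      Bound25Printed A gk κ C ∧ ∀ (u : 𝓖) (X : A.Poly) (U : A.Cfg), A.act X (gact u U) = A.act X U :=
  Iff.rfl

/-- First half, by name: «The terms 𝒫′_{k+1} satisfy the bound (25) (with the indices 1, 0 replaced by k + 1, k)».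
[cite: Balaban1985UV3, p.270 ll.35–36; (25) p.262] -/
theorem Terms59Printed.bound25 (h : Terms59Printed A gact gk κ C) : Bound25Printed A gk κ C :=
  h.1

/-- Second half: «and are gauge invariant functions of U_{k+1}». [cite: Balaban1985UV3, p.270 ll.36–37] -/
theorem Terms59Printed.gaugeInv (h : Terms59Printed A gact gk κ C) (u : 𝓖) (X : A.Poly) (U : A.Cfg) :
    A.act X (gact u U) = A.act X U :=
  h.2 u X U

/-- Both halves together: the decay bound (25) of a localized term is the same at every gauge transform of the configuration
(«in fact of an arbitrary gauge field configuration having regularity properties similar to the properties of U_{k+1}») — kernel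
triviality. [cite: Balaban1985UV3, p.270 ll.35–38; (25) p.262] -/
theorem Terms59Printed.abs_act_gauge_le (h : Terms59Printed A gact gk κ C) (u : 𝓖) (X : A.Poly) (U : A.Cfg) :
    |A.act X (gact u U)| ≤ C * gk * Real.exp (-(κ * A.ℒ X)) := by
  rw [h.gaugeInv u X U]
  exact h.bound25 X U

end Terms59

/-! ## §2  The bundle: the printed statements of pp. 267–275 as hypotheses, by name, keyed to the DAG leaf `b10` -/

/-- **Carriers of the block-32 bundle** beyond the family of runs `T : I → B10.TowerRun` (which already carries, per run, the
densities ρ_k, the history functional of (41), the composite minimizer's action (42), the interaction sum (43), E_k, the Z-terms,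
the remainder, |T₁^{(k)}|, g_k and the parameters M₁, b₀, p₀ of (7)) — one group of fields for the §1 statement, plain data: for
every run `i` and step `k` (the passage k → k + 1 of Sect. C) the localized expansion of (59) `A i k : B10.PolymerActivities`
(Σ_X 𝒫′_{k+1}(g_k, X, ·)), the gauge transformations `𝓖 i k` with their action `gact i k` on `(A i k).Cfg`, and the two constants of
(25): the decay rate `κ` («κ can be arbitrarily large if M₁ is sufficiently large», p. 262) and the `O(·)` constant `C25`.
[cite: Balaban1985UV3, (59) p.270 + (25) p.262] -/
structure Carriers (I : Type) where
  A : I → ℕ → PolymerActivities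
  𝓖 : I → ℕ → Type
  gact : (i : I) → (k : ℕ) → 𝓖 i k → (A i k).Cfg → (A i k).Cfg
  κ : ℝ
  C25 : ℝ

/-- **BLOCK 32 OF [B10] AS ONE HYPOTHESIS BUNDLE** (pp. 267–275 [PDF 13–21]): the printed theorem-level statements of the block
that the tree carries in hypothesis form over the carrier of record `B10.TowerRun`, for a family of runs `T : I → B10.TowerRun`
(all lattice approximations: «independent of ε»), conjoined BY NAME, in page order —
`b46` = **(46) p. 267** «Σ_{j=1}^k Σ_{Y_j} |𝒫_j(Y_j, U_k)| ≤ O(1)M₁³g²_{k−1}p²(g_{k−1})|Λ_k|. Thus the sum is not only convergent, but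
also small.» (`B10.Bound46Printed`, from (43)–(45));
`sectC` = **Sect. C pp. 267–272**, the inductive step (41)_k ∧ (47)_k ⇒ (41)_{k+1} ∧ (47)_{k+1} for 1 ≤ k, k + 1 ≤ K, through
(48)–(63) and the p. 272 absorptions «To get the exact inequality we estimate a sum of all terms 𝒫_j(Y_j, U_{k+1}) with localizations
Y_j not contained in Ω_{k+1} by O(1)|Λ_k|, or by O(1)|Z_k|. The lower bound is proved in the same way, with all simplifications
coming from the fact that Ω_{k+1} = T_η.» (`B10.SectCStepPrinted`);
`t59` = **p. 270 ll. 35–38**, the localized terms of (59) at every step k + 1 ≤ K obey (25) and are gauge invariant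
(`Terms59Printed`, §1);
`thm2` = **THEOREM 2 p. 272** «The sequence of densities ρ_k defined by the inductive equations (2), with ρ₀ given by (1), satisfies
the inequalities (41), (47).» (`B10.Thm2Printed`, on the underlying `B10.RunData` of every run);
`sectD` = **Sect. D pp. 272–275** «We have to show that the inequalities (41), (47) imply Theorem 1, i.e. the inequalities (5).»
(`B10.Thm1OfThm2Leaf` — the implication leaf in the one-sided printed reading of Theorem 1, cell GAPS G-B10-01; see the module
docstring's HONEST SCOPE and `Hyp.bounds5At` for what the leaves give per coupling window);
`lf` = **(67)–(71) p. 273 + p. 273 l. 31 – p. 274 l. 3** «We get these small factors for all plaquettes in all large fields set P. …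
The analysis of Sect. 3.C [9], which is model independent, show that these small factors are enough to control all sums in (41),
together with the second term in (65) ⟦(66)⟧. This gives the upper bound in (5).» (`B10.LargeFieldControlPrinted`).
The displays (44)–(45), (48)–(63), (64)–(66), (69)–(71) are PROVED ∕ bodied ∕ typed as inputs of these in the sibling modules
(module docstring's table) and take no slot; (47) `B10.Ineq47` enters as the input/output of `sectC` and as the lower half of
`thm2`'s conclusion (`Hyp.ineq41_47`).  Hypothesis slot only; nothing asserted.
[cite: Balaban1985UV3, (46) p.267, Sect. C pp.267–272, p.270 ll.35–38, Thm 2 p.272, Sect. D pp.272–275, (67)–(71) pp.273–274] -/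
structure Hyp {I : Type} (T : I → TowerRun) (X : Carriers I) : Prop where
  /-- (46) p. 267 — in tree: `B10.Bound46Printed`. -/
  b46 : ∀ i, Bound46Printed (T i)
  /-- Sect. C pp. 267–272, the inductive step — in tree: `B10.SectCStepPrinted`. -/
  sectC : ∀ i, SectCStepPrinted (T i)
  /-- p. 270 ll. 35–38, (25) and gauge invariance of the terms of (59) at every step k + 1 ≤ K — §1 `Terms59Printed`. -/
  t59 : ∀ i k, k + 1 ≤ (T i).K → Terms59Printed (X.A i k) (X.gact i k) ((T i).g k) X.κ X.C25
  /-- Theorem 2 p. 272 — in tree: `B10.Thm2Printed`. -/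
  thm2 : Thm2Printed (fun i => (T i).toRunData)
  /-- Sect. D pp. 272–275, «(41), (47) imply Theorem 1» — in tree: `B10.Thm1OfThm2Leaf`. -/
  sectD : Thm1OfThm2Leaf (fun i => (T i).toRunData)
  /-- (67)–(71) + [9] Sect. 3.C, pp. 273–274 — in tree: `B10.LargeFieldControlPrinted`. -/
  lf : ∀ i, LargeFieldControlPrinted (T i)

/-! ## §3  Bookkeeping (kernel-checked uses of the cited declarations; no statement asserted) -/

section Bookkeeping

variable {I : Type} {T : I → TowerRun} {X : Carriers I}

/-- ★ **The consumer's form**: the bundle yields the DAG's node-n08 leaf for the family — Theorem 1 (p. 257, printed reading) ∧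
Theorem 2 (p. 272) on the underlying runs: Theorem 2 is the slot `thm2`, Theorem 1 is Sect. D's leaf `sectD` applied to it.
Bookkeeping; nothing of the paper is proved. [cite: Balaban1985UV3, Thm 2 p.272 + Sect. D pp.272–275 (bookkeeping)] -/
theorem Hyp.b10Leaf (h : Hyp T X) :
    Thm1Printed (fun i => (T i).toRunData) ∧ Thm2Printed (fun i => (T i).toRunData) :=
  ⟨h.sectD h.thm2, h.thm2⟩

/-- ★ **Keyed to the K-consumer's upstream binding**: when the DAG record's B10 family `P.runs10` IS the family of underlying runs,
the bundle gives LITERALLY the field `b10` of `DagBinding.Upstream.ofPrinted P b9 b11 rOp rBS` (= `B10.Thm1Printed P.runs10 ∧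
B10.Thm2Printed P.runs10`; the same field in the later bindings `ofPrintedR`, `ofPrintedAll…`, by `DagBinding.ofPrintedR_leaves`,
`ofPrintedAllXP_leaves`).  Bookkeeping. [cite: Balaban1985UV3, Thm 2 p.272 + Sect. D pp.272–275 (bookkeeping)] -/
theorem Hyp.dag_b10 (P : DagBinding.PrintedCarriers) {T : P.I10 → TowerRun} {X : Carriers P.I10} (h : Hyp T X)
    (hP : P.runs10 = fun i => (T i).toRunData) (b9 b11 rOp rBS : Prop) :
    (DagBinding.Upstream.ofPrinted P b9 b11 rOp rBS).b10 := by
  show Thm1Printed P.runs10 ∧ Thm2Printed P.runs10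
  rw [hP]
  exact h.b10Leaf

/-- **(41) ∧ (47) at every step k ≤ K of every run** — Theorem 2's conclusion in the typed shapes `B10.Ineq41` / `B10.Ineq47`
(p. 266 (41), p. 267 (47)) through the binding `B10.SpecOK` of the abstract `Ineq41_47` of `B10.RunData`.  Bookkeeping.
[cite: Balaban1985UV3, Thm 2 p.272, (41) p.266, (47) p.267 (bookkeeping)] -/
theorem Hyp.ineq41_47 (h : Hyp T X) (hspec : ∀ i, SpecOK (T i)) (i : I) (k : ℕ) (hk : k ≤ (T i).K) :
    Ineq41 (T i) k ∧ Ineq47 (T i) k :=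
  ((hspec i) k).mp (h.thm2 i k hk)

/-- **The `thm2` slot is Theorem 2's printed proof shape**: the `sectC` slot (Sect. C, k → k + 1 for 1 ≤ k) together with the two
members printed on block 31's pages — (1) p. 256 at k = 0 (`B10.Step0Printed`) and the first step (36)–(37) p. 265
(`B10.FirstStep36_37Printed`) — re-derives `B10.Thm2Printed` by the induction on k the paper leaves implicit
(`B10.thm2_of_sections`).  Bookkeeping; every member a hypothesis. [cite: Balaban1985UV3, Thm 2 p.272 (bookkeeping)] -/
theorem Hyp.thm2_of_sectionsAB (h : Hyp T X) (hspec : ∀ i, SpecOK (T i)) (h0 : ∀ i, Step0Printed (T i))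
    (hA : ∀ i, FirstStep36_37Printed (T i)) : Thm2Printed (fun i => (T i).toRunData) :=
  B10.thm2_of_sections T hspec h0 hA h.sectC

/-- **(46) ⇒ Sect. D line 1** (p. 272 «We estimate the interaction terms using the bounds (44)–(46) by O(1)M₁³g²_{k−1}p²(g_{k−1})|Λ_k|
≤ O(1)|T₁^{(k)}|»): out of the slot `b46`, for a run whose couplings stay in (0, 1] («for g_{k−1} sufficiently small», p. 267) one
constant `a` bounds the interaction sum by `a|T₁^{(k)}|` at every 1 ≤ k ≤ K (`B10.Pint_le_of_bound46`, with `B10.gsq_psq_le`).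
Bookkeeping. [cite: Balaban1985UV3, (46) p.267 + Sect. D p.272 (bookkeeping)] -/
theorem Hyp.pint_le (h : Hyp T X) (i : I) (hp : 0 < (T i).p₀) (hM : 0 ≤ (T i).M₁)
    (hg : ∀ k, k ≤ (T i).K → 0 < (T i).g k ∧ (T i).g k ≤ 1)
    (hΛ : ∀ (k : ℕ) (hh : (T i).Hist k), 0 ≤ (T i).Λvol k hh) :
    ∃ a : ℝ, ∀ k, 1 ≤ k → k ≤ (T i).K → ∀ (hh : (T i).Hist k) (U : (T i).Cfg k),
      |(T i).Pint k hh U| ≤ a * (T i).sites k :=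
  B10.Pint_le_of_bound46 (T i) hp hM (h.b46 i) hg hΛ

/-- **(66) p. 273 out of the bundle**: Theorem 2 gives (41)_k (`Hyp.ineq41_47`), and with the three Sect. D piece bounds —
interaction ≤ a|T₁^{(k)}|, |E_k| ≤ b|T₁^{(k)}| ((64)–(65)), remainder ≤ c|T₁^{(k)}| — the display (66) holds with O(1) = a + b + c
(`B10Eq66UpperForm.ineq66_of_41`).  Bookkeeping. [cite: Balaban1985UV3, (66) p.273 (bookkeeping)] -/
theorem Hyp.ineq66 (h : Hyp T X) (hspec : ∀ i, SpecOK (T i)) (i : I) (k : ℕ) (hk : k ≤ (T i).K) {a b c : ℝ}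
    (hP : ∀ (hh : (T i).Hist k) (U : (T i).Cfg k), |(T i).Pint k hh U| ≤ a * (T i).sites k)
    (hE : |(T i).Ecst k| ≤ b * (T i).sites k) (hR : (T i).Rm k ≤ c * (T i).sites k) :
    B10Eq66UpperForm.Ineq66 (T i) (a + b + c) k :=
  B10Eq66UpperForm.ineq66_of_41 (T i) k (h.ineq41_47 hspec i k hk).1 hP hE hR

/-- **(66) + the large-field slot ⇒ the upper half of (5)** (p. 274 «This gives the upper bound in (5)»): with the constant `d` of
`lf`, `ρ_k ≤ e^{(a+b+c+d)|T₁^{(k)}|}` (`B10Eq66UpperForm.upper5_of_66`).  Bookkeeping. [cite: Balaban1985UV3, (66) p.273 + p.274 (bookkeeping)] -/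
theorem Hyp.upper5_via66 (h : Hyp T X) (hspec : ∀ i, SpecOK (T i)) (i : I) {a b c : ℝ}
    (hP : ∀ k, k ≤ (T i).K → ∀ (hh : (T i).Hist k) (U : (T i).Cfg k), |(T i).Pint k hh U| ≤ a * (T i).sites k)
    (hE : ∀ k, k ≤ (T i).K → |(T i).Ecst k| ≤ b * (T i).sites k)
    (hR : ∀ k, k ≤ (T i).K → (T i).Rm k ≤ c * (T i).sites k) :
    ∃ d : ℝ, 0 ≤ d ∧ ∀ k, k ≤ (T i).K → ∀ U : (T i).Cfg k,
      (T i).ρ k U ≤ Real.exp ((a + b + c + d) * (T i).sites k) := by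
  obtain ⟨d, hd, hLF⟩ := h.lf i
  exact ⟨d, hd, fun k hk U =>
    B10Eq66UpperForm.upper5_of_66 (T i) k (h.ineq66 hspec i k hk (hP k hk) (hE k hk) (hR k hk)) (hLF k hk) U⟩

/-- ★ **What the slots give of Theorem 1, per coupling window** (Sect. D pp. 272–274): Theorem 2 (`thm2`, through `B10.SpecOK`)
and the large-field control (`lf`, constant d ≥ 0), together with the three piece bounds with constants a, b, c (interaction —
from `b46` by `Hyp.pint_le` on (0, 1]; counterterm (64)–(65) — `B10.Ecst_abs_le_window`, window-dependent by the `d(𝔤) log g_k`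
term of (62); remainder — `B10.remainderSum_le`), give THE BOUNDS (5) AT EVERY STEP k ≤ K of the run with O(1) = a + b + c + d
(`B10.bounds5At_of_ineqs`).  This is the kernel content of the `sectD` sentence under the audit reading (`B10.Thm1PrintedCompact`,
`B10Assembly.thm1Compact_and_thm2_of_leafSystem`); bookkeeping, nothing asserted. [cite: Balaban1985UV3, Sect. D pp.272–274 + (5) p.256 (bookkeeping)] -/
theorem Hyp.bounds5At (h : Hyp T X) (hspec : ∀ i, SpecOK (T i)) (i : I) {a b c : ℝ}
    (hP : ∀ k, k ≤ (T i).K → ∀ (hh : (T i).Hist k) (U : (T i).Cfg k), |(T i).Pint k hh U| ≤ a * (T i).sites k)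
    (hE : ∀ k, k ≤ (T i).K → |(T i).Ecst k| ≤ b * (T i).sites k)
    (hR : ∀ k, k ≤ (T i).K → (T i).Rm k ≤ c * (T i).sites k) :
    ∃ d : ℝ, 0 ≤ d ∧ ∀ k, k ≤ (T i).K → Bounds5At (T i).toRunData (a + b + c + d) k := by
  obtain ⟨d, hd, hLF⟩ := h.lf i
  refine ⟨d, hd, fun k hk => ?_⟩
  have h4147 := h.ineq41_47 hspec i k hk
  exact B10.bounds5At_of_ineqs (T i) k a b c d hd h4147.1 h4147.2 (hP k hk) (hE k hk) (hR k hk) (hLF k hk)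

/-- **Four of the six slots are consequences of the cell's located leaf system** (`B10Assembly.LeafSystem C (T i)` for every run:
the fourteen step leaves of Sects. A/C, (46) with the family's O(1), the large-field control with the family's d, the binding and
(1)₀): `b46` (field `bound46` with `C.C46 ≥ 0`), `sectC` (`B10SectAGathering.sectCStep_of_leaves` on the fields `steps`, `g_le_one`),
`thm2` (`B10Assembly.thm2_of_leafSystem`), `lf` (field `lf` with `C.d ≥ 0`); the p. 270 slot `t59` and the one-sided Sect. D slot
`sectD` are supplied.  Bookkeeping. [cite: Balaban1985UV3, Thm 2 p.272 + (46) p.267 + pp.273–274 (bookkeeping)] -/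
theorem hyp_of_leafSystem {C : B10Assembly.Consts} (T : I → TowerRun) (X : Carriers I)
    (S : ∀ i, B10Assembly.LeafSystem C (T i))
    (h59 : ∀ i k, k + 1 ≤ (T i).K → Terms59Printed (X.A i k) (X.gact i k) ((T i).g k) X.κ X.C25)
    (hD : Thm1OfThm2Leaf (fun i => (T i).toRunData)) : Hyp T X where
  b46 i := ⟨C.C46, C.C46_nonneg, (S i).bound46⟩
  sectC i := B10SectAGathering.sectCStep_of_leaves (T i)
    (fun k hk => ⟨(S i).g_pos k, (S i).g_le_one k (by omega)⟩) (fun k _ hk => (S i).steps k hk)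
  t59 := h59
  thm2 := B10Assembly.thm2_of_leafSystem T S
  sectD := hD
  lf i := ⟨C.d, C.d_nonneg, (S i).lf⟩

end Bookkeeping

/-! ## §4  Non-vacuity: the bundle is inhabited (the cell's trivial run) -/

section Witness

/-- The zero localized expansion: one localization, one configuration, 𝓛 ≡ 0, all activities 0. [folklore] -/
def trivActivities : PolymerActivities where
  Poly := Unit
  Cfg := Unit
  ℒ := fun _ => 0
  act := fun _ _ => 0

/-- Carriers for the one-member family of the trivial run: zero activities, the trivial gauge group acting identically,
κ = C = 0. [folklore] -/
def trivCarriers : Carriers Unit where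
  A := fun _ _ => trivActivities
  𝓖 := fun _ _ => Unit
  gact := fun _ _ _ U => U
  κ := 0
  C25 := 0

/-- The zero activities satisfy the p. 270 sentence with C = 0 (|0| ≤ 0) under the identity action — a NON-VACUITY INSTANCE of
the typed sentence (consistency of the typing, nothing about gauge theory). [cite: Balaban1985UV3, p.270 ll.35–38 (non-vacuity instance)] -/
theorem terms59_triv (gk : ℝ) :
    Terms59Printed trivActivities (fun (_ : Unit) (U : trivActivities.Cfg) => U) gk 0 0 :=
  ⟨fun X U => by simp [trivActivities], fun _ _ _ => rfl⟩

/-- On the cell's trivial run (`B10Assembly.trivRun K`: ρ_k ≡ χ_k ≡ 1, zero action, one history per scale) the one-sided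
Theorem 1 holds with O(1) = 0, so the Sect. D leaf holds there — a NON-VACUITY INSTANCE of the typed leaf (consistency of the
typing, nothing about gauge theory). [cite: Balaban1985UV3, Sect. D pp.272–275 (non-vacuity instance)] -/
theorem thm1OfThm2Leaf_trivRun (K : ℕ) : Thm1OfThm2Leaf (fun _ : Unit => (B10Assembly.trivRun K).toRunData) := by
  intro _ gmax _
  refine ⟨0, fun _ _ k _ U => ?_⟩
  constructor <;> simp [B10Assembly.trivRun]

/-- **The block-32 bundle is inhabited** for every depth K: the one-member family of the cell's trivial run, through its leaf
system `B10Assembly.trivLeafSystem K` (`hyp_of_leafSystem`), the zero activities and the trivial Sect. D leaf — so the six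
slots are jointly satisfiable as typed (and, with carriers free, vacuous in isolation: the bundle earns its keep only at
Bałaban's objects (1)–(2)).  A NON-VACUITY INSTANCE of the typed bundle (consistency of the typing, nothing about gauge
theory). [cite: Balaban1985UV3, (46) p.267 + Sect. C pp.267–272 + p.270 + Thm 2 p.272 + Sect. D pp.272–275 + (67)–(71) pp.273–274 (non-vacuity instance)] -/
theorem hyp_trivRun (K : ℕ) : Hyp (fun _ : Unit => B10Assembly.trivRun K) trivCarriers :=
  hyp_of_leafSystem (C := B10Assembly.trivConsts) (fun _ : Unit => B10Assembly.trivRun K) trivCarriers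
    (fun _ => B10Assembly.trivLeafSystem K) (fun _ _ _ => terms59_triv _) (thm1OfThm2Leaf_trivRun K)

/-- … and the consumer's form applies to it: the DAG leaf `b10` holds for the trivial one-member family — a NON-VACUITY
INSTANCE (consistency of the typing, nothing about gauge theory). [cite: Balaban1985UV3, Thm 2 p.272 + Sect. D pp.272–275 (non-vacuity instance)] -/
theorem b10Leaf_trivRun (K : ℕ) :
    Thm1Printed (fun _ : Unit => (B10Assembly.trivRun K).toRunData)
      ∧ Thm2Printed (fun _ : Unit => (B10Assembly.trivRun K).toRunData) :=
  (hyp_trivRun K).b10Leaf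

end Witness

end Literature.MathematicalPhysics.QuantumFieldTheory.Balaban1983to89.B10Carve32SectsCDThm2Hyp

end
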